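import Summits.HodgeConjecture.CorCM.Census.OddDegreeParityLaw
import Mathlib.GroupTheory.OrderOfElement
import Mathlib.GroupTheory.Coset.Card
import Mathlib.GroupTheory.GroupAction.Quotient

/-!
# The odd-degree parity law, II: faithfulness, the full slice of `ℤ/2 × A` for `|A|` odd, and `μ(ℤ/2p) ≥ (2^{p−1} − 1)/p`

COR-CM (cell `pub-hodgecm2`), count-neutral kernel census by the binder seat b17 (gen 48; claim ODD-PARITY-LAW, sequel of
`Census/OddDegreeParityLaw.lean`).  Theorems + bookkeeping definitions, Mathlib-only mathematics, no `decide` table, no named fact,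
no `sorry`.  HC_CM is not proved anywhere in this cell; nothing here is a headline and nothing here produces a period.

§1 FAITHFULNESS (why the odd slice model of part I is the slice of record when `|G| ≡ 2 (mod 4)`).  For an abelian group `A` of ODD
order and any `φ : A → ℤ/2` (a CM type of `(ℤ/2 × A, (1,0))`, dictionary of part I): `no_antiperiod` — no `y₀` with
`φ(y + y₀) = φ(y) + 1` for all `y` (iterate `|y₀|` times, `|y₀|` odd); `stabiliser_fst_eq_zero` — if `(a₀, y₀)` stabilises the type
(`φ(y − y₀) + a₀ = φ(y)`), then `a₀ = 0` and `y₀ ∈ Per(φ)` (`periods φ`, an `AddSubgroup`); `odd_card_quotient_periods` — the label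
group `A / Per(φ)` of the corresponding simple factor has odd order.  So every simple factor of every such slice is a block of the
model of part I with an odd label group, and the hypothesis `hodd` of the law is automatic; the block `E` (constant `φ`,
`Per = A`, `A_E = 0`) is the CM elliptic curve of the imaginary quadratic subfield `F^A`.

§2–§3 THE ACTION, AND THE CYCLIC PRIME CASE `A = ℤ/p`, `p` an odd prime (`G = ℤ/2p`, e.g. `F = ℚ(ζ₇)`, `ℚ(ζ₁₁)`, `ℚ(ζ_q)` for
primes `q ≡ 3 (mod 4)`).  `Nonconst A` = the `2^{|A|} − 2` nonconstant maps `A → ℤ/2`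
(`card_nonconst`, any `A`) with the translation–complement `AddAction` of `ℤ/2 × A` (`shift`, `vadd_val`); `period_eq_zero` (a
nonconstant map on `ℤ/p` has no nonzero period) and **`vadd_eq_self_iff`** (the action is FREE: nonconstant = primitive, every
simple factor `≠ E` has CM by `F` itself, dimension `p`, label set `G`); **`card_orbits_mul` / `card_orbits_eq`** (Burnside):
the number of orbits — isogeny classes of simple CM `p`-folds split by `F` — is `(2^p − 2)/(2p) = (2^{p−1} − 1)/p`
(`1, 3, 9, 93, 315, 3855` for `p = 3, 5, 7, 11, 13, 17`; binary necklaces of prime length up to rotation and complement).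

§4 THE FULL SLICE OF `(ℤ/2p, p)` AND THE HEADLINE.  Blocks `Option (Orbits p)`: `none = E` with `A_E = PUnit = 0`, `πE = 0`,
constant type; `some ω` = the primitive block of the orbit `ω` with `A = ℤ/p`, `π = id`, type a representative `ω.out`
(`AbO`, `πO`, `φO`; this is the faithful full slice: one block per simple factor, labels `G / Stab`).  **`cyclicPrime_law`**: for
`p ≠ 2`, every finite `S ⊂ ℤ^{Pt}` with `hodgeLattice ≤ pairs ⊔ ℤ[G]·S` has `|S| ≥ (2^p − 2)/(2p)` — part I's
`card_sub_one_le_card_of_generates` with `|ι| − 1 = #Orbits`.  This is the «`ℤ/2p` law» stated in the memo of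
`Census/TetradecicCyclicSpecies.lean` (lit-andre-3 gen 13), for all `p` at once; at `p = 3, 5, 7` the per-degree lattice
certificates (`Census/CyclicSextic*`, `DecicCyclic*`, `TetradecicCyclic*`) show equality `μ = 1, 3, 9`.
§5 ANY `A` OF ODD ORDER (`ℤ/9`, `(ℤ/3)²`, `ℤ/15`, …): the faithful full slice with blocks `Option (OrbitsA A)` — `E`, and for
each `G`-orbit `ω` of nonconstant types the simple factor with label group `A / Per(φ_ω)` (`AbQ`, `πQ` = quotient map,
`φQ` = `descend`ed representative type) — and **`oddSlice_law`**: `|A|` odd ⟹ `hodgeLattice ≤ pairs ⊔ ℤ[G]·S → #OrbitsA A ≤ |S|`,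
i.e. `μ(ℤ/2 × A) ≥` the number of isogeny classes of simple CM abelian varieties split by `F` other than `E` (`29` for `ℤ/18`,
`31` for `ℤ/6 × ℤ/3`, `1095` for `ℤ/30` by orbit counting — these counts are NOT decided here; the prime case is §3).
NOT CLAIMED: any upper bound (equality only at `2p = 6, 10, 14`, by the per-degree certificates); which representatives
`Quotient.out` picks (irrelevant: conjugate types give isomorphic slices, and the law holds for every choice); NON-ABELIAN `A`:
`|G| ≡ 2 (mod 4)` only forces `G = ⟨c⟩ × A` with `A` the normal `2`-complement of odd order, possibly non-abelian (e.g.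
`ℤ/2 × (ℤ/7 ⋊ ℤ/3)`, degree `42`); both files take `A` abelian (`AddCommGroup`), which covers every abelian CM Galois group of
order `≡ 2 (mod 4)` — the non-abelian odd complements are not treated here.

## References
* [Pohlmann1968] H. Pohlmann, Algebraic cycles on abelian varieties of complex multiplication type, Ann. of Math. 88 (1968), Thm 1.
* [Milne1999] J. S. Milne, Lefschetz motives and the Tate conjecture, Compositio Math. 117 (1999), Prop. 2.1, p. 54.
* [Shimura1998] G. Shimura, Abelian Varieties with Complex Multiplication and Modular Functions (1998), §8.2, Prop. 26.
-/

namespace Summit.HodgeConjecture.CorCM.Census.OddDegreeParityLaw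

open Finset

/-! ## §1 Faithfulness for `|G| ≡ 2 (mod 4)`: no anti-periods on a group of odd order -/

section Faithful

variable {A : Type*} [AddCommGroup A] [Fintype A]

omit [Fintype A] in
/-- Iterating a shift relation `φ(y + y₀) = φ(y) + a₀`. [folklore] -/
theorem apply_add_nsmul (φ : A → ZMod 2) (y₀ : A) (a₀ : ZMod 2) (h : ∀ y, φ (y + y₀) = φ y + a₀) (y : A) (n : ℕ) :
    φ (y + n • y₀) = φ y + n • a₀ := by
  induction n with
  | zero => simp
  | succ n ih => rw [succ_nsmul, ← add_assoc, h, ih, succ_nsmul, add_assoc]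

/-- **No anti-periods in odd order.**  On an abelian group of odd order no map `φ : A → ℤ/2` satisfies
`φ(y + y₀) = φ(y) + 1` for all `y`. [folklore] -/
theorem no_antiperiod (hA : Odd (Fintype.card A)) (φ : A → ZMod 2) (y₀ : A) : ¬ ∀ y, φ (y + y₀) = φ y + 1 := by
  have h01 : ∀ a : ZMod 2, a = 0 ∨ a = 1 := by decide
  intro h
  have hn : addOrderOf y₀ ∣ Fintype.card A := addOrderOf_dvd_card
  have hodd : Odd (addOrderOf y₀) := hA.of_dvd_nat hn
  have key := apply_add_nsmul φ y₀ 1 h 0 (addOrderOf y₀)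
  rw [addOrderOf_nsmul_eq_zero, add_zero, nsmul_eq_mul, mul_one, (ZMod.natCast_eq_one_iff_odd).mpr hodd] at key
  rcases h01 (φ 0) with h0 | h1
  · rw [h0] at key; exact absurd key (by decide)
  · rw [h1] at key; exact absurd key (by decide)

/-- **Stabilisers of CM types of `(ℤ/2 × A, (1,0))`, `|A|` odd.**  If `(a₀, y₀)` stabilises the type of `φ`, i.e.
`φ(y − y₀) + a₀ = φ(y)` for all `y`, then `a₀ = 0` and `y₀` is a period of `φ`: every stabiliser is `{0} × Per(φ)`, so every
simple factor of the slice has the label set `ℤ/2 × (A / Per φ)`. [folklore] -/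
theorem stabiliser_fst_eq_zero (hA : Odd (Fintype.card A)) (φ : A → ZMod 2) (a₀ : ZMod 2) (y₀ : A)
    (h : ∀ y, φ (y - y₀) + a₀ = φ y) : a₀ = 0 ∧ ∀ y, φ (y + y₀) = φ y := by
  have h01 : ∀ a : ZMod 2, a = 0 ∨ a = 1 := by decide
  have h' : ∀ y, φ (y + y₀) = φ y + a₀ := fun y => by
    have := h (y + y₀)
    rw [add_sub_cancel_right] at this
    exact this.symm
  rcases h01 a₀ with h0 | h1
  · subst h0
    exact ⟨rfl, fun y => by simpa using h' y⟩
  · subst h1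
    exact absurd h' (no_antiperiod hA φ y₀)

/-- The periods of `φ : A → ℤ/2` form a subgroup `Per(φ)`. [folklore] -/
def periods (φ : A → ZMod 2) : AddSubgroup A where
  carrier := {y₀ | ∀ y, φ (y + y₀) = φ y}
  zero_mem' := by intro y; simp
  add_mem' := by
    intro u v hu hv y
    show φ (y + (u + v)) = φ y
    rw [← add_assoc, hv (y + u), hu y]
  neg_mem' := by
    intro u hu y
    show φ (y + -u) = φ y
    have h := hu (y + -u)
    rw [neg_add_cancel_right] at h
    exact h.symm

/-- **Odd label groups.**  For `|A|` odd the label group `A / Per(φ)` of every block has odd order: the hypothesis `hodd` of the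
parity law is met by every faithful slice of `(ℤ/2 × A, (1,0))`. [folklore] -/
theorem odd_card_quotient_periods (hA : Odd (Fintype.card A)) (φ : A → ZMod 2) :
    Odd (Nat.card (A ⧸ periods φ)) := by
  have h := AddSubgroup.card_quotient_dvd_card (periods φ)
  rw [Nat.card_eq_fintype_card (α := A)] at h
  exact hA.of_dvd_nat h

end Faithful

/-! ## §2 Nonconstant types and the translation–complement action of `ℤ/2 × A` -/

section Action

variable (A : Type*) [AddCommGroup A]

/-- CM types of `(ℤ/2 × A, (1,0))` other than the two constant ones (the type of the CM elliptic curve `E` of the imaginary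
quadratic subfield and its conjugate), as maps `φ : A → ℤ/2`. [folklore] -/
abbrev Nonconst := {φ : A → ZMod 2 // ¬ ∀ y, φ y = φ 0}

/-- The action of `G = ℤ/2 × A` on types: `((a₀, y₀) · φ)(y) = φ(y − y₀) + a₀` (translation and complement). [folklore] -/
def shift (g : ZMod 2 × A) (φ : A → ZMod 2) : A → ZMod 2 := fun y => φ (y - g.2) + g.1

/-- `shift` preserves non-constancy. [folklore] -/
theorem shift_nonconst (g : ZMod 2 × A) (φ : A → ZMod 2) (hφ : ¬ ∀ y, φ y = φ 0) :
    ¬ ∀ y, shift A g φ y = shift A g φ 0 := by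
  intro h
  apply hφ
  intro y
  have h1 := h (y + g.2)
  have h2 := h g.2
  simp only [shift, add_sub_cancel_right, sub_self, zero_sub] at h1 h2
  have h1' : φ y = φ (-g.2) := add_right_cancel h1
  have h2' : φ 0 = φ (-g.2) := add_right_cancel h2
  rw [h1', h2']

/-- `G = ℤ/2 × A` acts on the nonconstant types. [folklore] -/
instance : AddAction (ZMod 2 × A) (Nonconst A) where
  vadd g φ := ⟨shift A g φ.1, shift_nonconst A g φ.1 φ.2⟩
  zero_vadd φ := by
    apply Subtype.ext
    funext y
    show φ.1 (y - 0) + 0 = φ.1 y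
    simp
  add_vadd g h φ := by
    apply Subtype.ext
    funext y
    show φ.1 (y - (g.2 + h.2)) + (g.1 + h.1) = φ.1 (y - g.2 - h.2) + h.1 + g.1
    rw [sub_sub, add_assoc, add_comm h.1 g.1]

/-- The action, unfolded. [folklore] -/
theorem vadd_val (g : ZMod 2 × A) (φ : Nonconst A) (y : A) : (g +ᵥ φ).1 y = φ.1 (y - g.2) + g.1 := rfl
/-- There are `2^{|A|} − 2` nonconstant types. [folklore] -/
theorem card_nonconst [Fintype A] [DecidableEq A] : Fintype.card (Nonconst A) = 2 ^ Fintype.card A - 2 := by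
  classical
  rw [Fintype.card_subtype_compl, Fintype.card_fun, ZMod.card]
  have hc : Fintype.card {φ : A → ZMod 2 // ∀ y, φ y = φ 0} = Fintype.card (ZMod 2) := by
    refine Fintype.card_congr ⟨fun φ => φ.1 0, fun a => ⟨fun _ => a, fun _ => rfl⟩, ?_, ?_⟩
    · intro φ; apply Subtype.ext; funext y; exact (φ.2 y).symm
    · intro a; rfl
  rw [hc, ZMod.card]

end Action

/-! ## §3 The cyclic prime case `A = ℤ/p`: the action is free, `(2^p − 2)/(2p)` orbits -/

section CyclicPrime

variable (p : ℕ) [hp : Fact p.Prime]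

/-- A nonconstant map on `ℤ/p` (`p` prime) has no nonzero period. [folklore] -/
theorem period_eq_zero (φ : ZMod p → ZMod 2) (hφ : ¬ ∀ y, φ y = φ 0) (y₀ : ZMod p) (h : ∀ y, φ (y + y₀) = φ y) :
    y₀ = 0 := by
  by_contra hy
  apply hφ
  intro y
  have key := apply_add_nsmul φ y₀ 0 (fun y => by rw [h y, add_zero]) 0 ((y * y₀⁻¹).val)
  rw [zero_add, nsmul_eq_mul, ZMod.natCast_zmod_val, inv_mul_cancel_right₀ hy, smul_zero, add_zero] at key
  exact key

/-- **Freeness.**  The stabiliser of every nonconstant type is trivial (`p` an odd prime): the `(2^p − 2)` nonconstant types are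
the PRIMITIVE types, each simple factor `B ≠ E` of the slice has CM by `F` itself and label set `G`. [folklore] -/
theorem vadd_eq_self_iff (hp2 : p ≠ 2) (g : ZMod 2 × ZMod p) (φ : Nonconst (ZMod p)) : g +ᵥ φ = φ ↔ g = 0 := by
  constructor
  · intro h
    have hA : Odd (Fintype.card (ZMod p)) := by
      rw [ZMod.card]; exact hp.out.odd_of_ne_two hp2
    have h' : ∀ y, φ.1 (y - g.2) + g.1 = φ.1 y := fun y => by
      have := congrArg (fun ψ : Nonconst (ZMod p) => ψ.1 y) h
      exact this
    obtain ⟨h1, h2⟩ := stabiliser_fst_eq_zero hA φ.1 g.1 g.2 h'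
    have h3 := period_eq_zero p φ.1 φ.2 g.2 h2
    exact Prod.ext h1 h3
  · rintro rfl; exact zero_vadd _ _

/-- **Orbit count.**  The number of `G`-orbits of nonconstant types — the number of isogeny classes of simple CM abelian varieties
split by `F` other than `E` (all of dimension `p`, with CM by `F`) — times `2p` is `2^p − 2`; i.e. it equals `(2^{p−1} − 1)/p`
(`p` an odd prime). [folklore] -/
theorem card_orbits_mul (hp2 : p ≠ 2) :
    Nat.card (AddAction.orbitRel.Quotient (ZMod 2 × ZMod p) (Nonconst (ZMod p))) * (2 * p) = 2 ^ p - 2 := by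
  classical
  have burnside :=
    AddAction.sum_card_fixedBy_eq_card_orbits_mul_card_addGroup (ZMod 2 × ZMod p) (Nonconst (ZMod p))
  have hfix : ∀ g : ZMod 2 × ZMod p, Fintype.card (AddAction.fixedBy (Nonconst (ZMod p)) g) =
      if g = 0 then Fintype.card (Nonconst (ZMod p)) else 0 := by
    intro g
    by_cases hg : g = 0
    · subst hg
      rw [if_pos rfl]
      refine Fintype.card_congr (Equiv.subtypeUnivEquiv fun φ => ?_)
      show (0 : ZMod 2 × ZMod p) +ᵥ φ = φ
      exact zero_vadd _ _
    · rw [if_neg hg, Fintype.card_eq_zero_iff]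
      refine ⟨fun ⟨φ, hφ⟩ => hg ((vadd_eq_self_iff p hp2 g φ).mp hφ)⟩
  simp_rw [hfix] at burnside
  rw [Finset.sum_ite_eq' univ (0 : ZMod 2 × ZMod p), if_pos (mem_univ _), card_nonconst,
    Fintype.card_prod, ZMod.card, ZMod.card] at burnside
  rw [Nat.card_eq_fintype_card]
  exact burnside.symm

/-- The orbit count as a quotient: `#orbits = (2^p − 2)/(2p) = (2^{p−1} − 1)/p`. [folklore] -/
theorem card_orbits_eq (hp2 : p ≠ 2) :
    Nat.card (AddAction.orbitRel.Quotient (ZMod 2 × ZMod p) (Nonconst (ZMod p))) = (2 ^ p - 2) / (2 * p) := by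
  have h := card_orbits_mul p hp2
  have hpos : 0 < 2 * p := by have := hp.out.pos; omega
  rw [← h, Nat.mul_div_cancel _ hpos]

end CyclicPrime

/-! ## §4 The full slice of `(ℤ/2p, p)`: `μ(ℤ/2p) ≥ (2^{p−1} − 1)/p` -/

section FullSlice

variable (p : ℕ) [hp : Fact p.Prime]

/-- The `G`-orbits of nonconstant (= primitive) types: the simple CM abelian varieties split by `F` other than `E`, up to
isogeny (all of dimension `p`, CM by `F`). [folklore] -/
abbrev Orbits : Type := AddAction.orbitRel.Quotient (ZMod 2 × ZMod p) (Nonconst (ZMod p))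

/-- The orbit space is finite (classical enumeration). [folklore] -/
noncomputable instance : Fintype (Orbits p) := Fintype.ofFinite _

/-- The orbit space has (classical) decidable equality. [folklore] -/
noncomputable instance : DecidableEq (Orbits p) := Classical.decEq _

/-- Label groups of the full slice: `A_E = 0` for the block `E` (`none`), `A_B = ℤ/p` for each primitive block. [folklore] -/
def AbO : Option (Orbits p) → Type
  | none => PUnit
  | some _ => ZMod p

/-- The label groups are additive groups. [folklore] -/
instance instAddCommGroupAbO : ∀ b : Option (Orbits p), AddCommGroup (AbO p b)
  | none => inferInstanceAs (AddCommGroup PUnit)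
  | some _ => inferInstanceAs (AddCommGroup (ZMod p))

/-- The label groups are finite. [folklore] -/
instance instFintypeAbO : ∀ b : Option (Orbits p), Fintype (AbO p b)
  | none => inferInstanceAs (Fintype PUnit)
  | some _ => inferInstanceAs (Fintype (ZMod p))

/-- The label groups have decidable equality. [folklore] -/
instance instDecidableEqAbO : ∀ b : Option (Orbits p), DecidableEq (AbO p b)
  | none => inferInstanceAs (DecidableEq PUnit)
  | some _ => inferInstanceAs (DecidableEq (ZMod p))

/-- `G = ℤ/2 × ℤ/p` acts on the labels of `E` through `ℤ/p → 0` and on the primitive blocks through the identity. [folklore] -/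
def πO : ∀ b : Option (Orbits p), ZMod p →+ AbO p b
  | none => 0
  | some _ => AddMonoidHom.id (ZMod p)

/-- The types of the blocks: `E` has the constant type `0`; the primitive block of an orbit has (a representative of) its type.
[folklore] -/
noncomputable def φO : ∀ b : Option (Orbits p), AbO p b → ZMod 2
  | none => fun _ => 0
  | some ω => (Quotient.out ω : Nonconst (ZMod p)).1

/-- **`μ(ℤ/2p) ≥ (2^{p−1} − 1)/p`** (`p` an odd prime).  In the full slice of the Galois CM type `(ℤ/2p, p)` — the CM elliptic
curve `E` of the imaginary quadratic subfield and one simple CM `p`-fold per isogeny class split by `F`, `(2^p − 2)/(2p)` of them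
(`card_orbits_eq`) — every finite family `S` whose Galois translates generate the Hodge lattice together with the divisor classes
has `|S| ≥ (2^p − 2)/(2p) = (2^{p−1} − 1)/p`: `1, 3, 9, 93, 315, 3855, …` for `2p = 6, 10, 14, 22, 26, 34, …`. [folklore] -/
theorem cyclicPrime_law (hp2 : p ≠ 2) (S : Finset (Pt (AbO p) → ℤ))
    (hS : hodgeLattice (πO p) (φO p) ≤
      pairs ⊔ Submodule.span ℤ {v | ∃ g : ZMod 2 × ZMod p, ∃ t ∈ S, v = transl (πO p) g t}) :
    (2 ^ p - 2) / (2 * p) ≤ S.card := by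
  have hodd : ∀ b : Option (Orbits p), Odd (Fintype.card (AbO p b)) := by
    rintro (_ | ω)
    · show Odd (Fintype.card PUnit)
      simp
    · show Odd (Fintype.card (ZMod p))
      rw [ZMod.card]
      exact hp.out.odd_of_ne_two hp2
  have he : ∀ y : AbO p none, y = 0 := fun _ => rfl
  have h := card_sub_one_le_card_of_generates (πO p) (φO p) hodd none he S hS
  rw [Fintype.card_option] at h
  have hc : Fintype.card (Orbits p) = (2 ^ p - 2) / (2 * p) := by
    rw [← Nat.card_eq_fintype_card]; exact card_orbits_eq p hp2
  omega

end FullSlice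

/-! ## §5 The full slice of `(ℤ/2 × A, (1,0))` for any `A` of odd order: `μ ≥` the number of non-`E` simple factors -/

section OddFullSlice

variable (A : Type) [AddCommGroup A] [Fintype A]

/-- The `G`-orbits of nonconstant types of `(ℤ/2 × A, (1,0))`: the isogeny classes of simple CM abelian varieties split by `F`
other than the CM elliptic curve `E`. [folklore] -/
abbrev OrbitsA : Type := AddAction.orbitRel.Quotient (ZMod 2 × A) (Nonconst A)

/-- The orbit space is finite (classical enumeration). [folklore] -/
noncomputable instance : Fintype (OrbitsA A) := Fintype.ofFinite _

/-- The orbit space has (classical) decidable equality. [folklore] -/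
noncomputable instance : DecidableEq (OrbitsA A) := Classical.decEq _

variable {A} in
omit [Fintype A] in
/-- A type descends to the label group `A / Per(φ)` of its simple factor. [folklore] -/
def descend (φ : A → ZMod 2) : A ⧸ periods φ → ZMod 2 :=
  Quotient.lift (s := QuotientAddGroup.leftRel (periods φ)) φ (fun x y h => by
    have h' : -x + y ∈ periods φ := QuotientAddGroup.leftRel_apply.mp h
    have := h' x
    rw [add_neg_cancel_left] at this
    exact this.symm)

variable {A} in
omit [Fintype A] in
/-- `descend` on representatives. [folklore] -/
theorem descend_mk (φ : A → ZMod 2) (x : A) : descend φ (x : A ⧸ periods φ) = φ x := rfl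

/-- Label groups of the faithful full slice: `A_E = 0`; the simple factor of the orbit `ω` has `A / Per(φ_ω)` for a representative
type `φ_ω` (its stabiliser is `{0} × Per(φ_ω)`, `stabiliser_fst_eq_zero`). [folklore] -/
def AbQ : Option (OrbitsA A) → Type
  | none => PUnit
  | some ω => A ⧸ periods (Quotient.out ω : Nonconst A).1

/-- The label groups are additive groups. [folklore] -/
noncomputable instance instAddCommGroupAbQ : ∀ b : Option (OrbitsA A), AddCommGroup (AbQ A b)
  | none => inferInstanceAs (AddCommGroup PUnit)
  | some ω => inferInstanceAs (AddCommGroup (A ⧸ periods (Quotient.out ω : Nonconst A).1))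

/-- The label groups are finite. [folklore] -/
noncomputable instance instFintypeAbQ : ∀ b : Option (OrbitsA A), Fintype (AbQ A b)
  | none => inferInstanceAs (Fintype PUnit)
  | some ω => Fintype.ofFinite (A ⧸ periods (Quotient.out ω : Nonconst A).1)

/-- The label groups have decidable equality. [folklore] -/
noncomputable instance instDecidableEqAbQ : ∀ b : Option (OrbitsA A), DecidableEq (AbQ A b)
  | none => inferInstanceAs (DecidableEq PUnit)
  | some ω => Classical.decEq (A ⧸ periods (Quotient.out ω : Nonconst A).1)

/-- `G` acts on the labels of `E` through `0` and on the block of `ω` through the quotient map `A → A / Per(φ_ω)`. [folklore] -/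
noncomputable def πQ : ∀ b : Option (OrbitsA A), A →+ AbQ A b
  | none => 0
  | some ω => QuotientAddGroup.mk' (periods (Quotient.out ω : Nonconst A).1)

/-- The types of the blocks: constant `0` on `E`, the descended representative type on the block of `ω`. [folklore] -/
noncomputable def φQ : ∀ b : Option (OrbitsA A), AbQ A b → ZMod 2
  | none => fun _ => 0
  | some ω => descend (Quotient.out ω : Nonconst A).1

/-- **`μ(ℤ/2 × A) ≥ #(non-E simple factors)`** for every abelian group `A` of ODD order.  In the faithful full slice of
`(ℤ/2 × A, (1,0))` — `E` and one simple factor per `G`-orbit `ω` of nonconstant types, with label group `A / Per(φ_ω)` — every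
finite family `S` whose Galois translates generate the Hodge lattice together with the divisor classes has
`|S| ≥ #orbits` (`29` for `ℤ/18`, `31` for `ℤ/6 × ℤ/3`, `1095` for `ℤ/30`, `(2^{p−1} − 1)/p` for `ℤ/2p`; the counts themselves are not
decided here except in the prime case, `card_orbits_eq`). [folklore] -/
theorem oddSlice_law (hA : Odd (Fintype.card A)) (S : Finset (Pt (AbQ A) → ℤ))
    (hS : hodgeLattice (πQ A) (φQ A) ≤
      pairs ⊔ Submodule.span ℤ {v | ∃ g : ZMod 2 × A, ∃ t ∈ S, v = transl (πQ A) g t}) :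
    Nat.card (OrbitsA A) ≤ S.card := by
  have hodd : ∀ b : Option (OrbitsA A), Odd (Fintype.card (AbQ A b)) := by
    rintro (_ | ω)
    · show Odd (Fintype.card PUnit)
      simp
    · rw [← Nat.card_eq_fintype_card]
      exact odd_card_quotient_periods hA (Quotient.out ω : Nonconst A).1
  have he : ∀ y : AbQ A none, y = 0 := fun _ => rfl
  have h := card_sub_one_le_card_of_generates (πQ A) (φQ A) hodd none he S hS
  rw [Fintype.card_option, Nat.add_sub_cancel, ← Nat.card_eq_fintype_card] at h
  exact h

end OddFullSlice

end Summit.HodgeConjecture.CorCM.Census.OddDegreeParityLaw
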